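import Mathlib
import HarnessLib
import Summits.Ventures.LatticeQCDFlow.Exactness.NCMCGeneralSpaceReplicaJackknifeDeltaMethod

/-!
# The delete-one-block jackknife of a SMOOTH FUNCTION OF SEVERAL POOLED MEANS (Fréchet form): coverage `→ L_R(q)`, with a perturbed replica-`t` lemma for a general limit variable

HONEST FRAMING: exact (Metropolis-corrected) sampling algorithms for lattice gauge theory;
figures of merit are autocorrelation/cost numbers at stated couplings and volumes; no
continuum-physics claim.

Venture `LatticeQCDFlow` (cell pub-lqcd), topic `Exactness`; FANOUT row 13 (`eng-snf`, GEN-25).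
NEW WORK of the cell (elementary asymptotic statistics) against Mathlib (Slutsky, Fréchet
derivative `hasFDerivAt_iff_tendsto`, portmanteau), the cell's `NCMCGeneralSpaceReplicaTStatistic`
/ `…Coverage` (a.e.-continuous mapping, null diagonal, atomless law of `t(Z)`), row 4's
`Scoring/MultivariateDeltaMethod` (`tendstoInMeasure_of_tendstoInDistribution_smul`,
`tendsto_fderivRemainderRatio`) and GEN-25's `…ReplicaJackknifeDeltaMethod` (jackknife algebra);
not a published result; no definition; nothing cited as a fact (jackknife / delta method NAMED
ONLY).

WHY (row 13).  `…ReplicaJackknifeDeltaMethod` treats `φ(pooled mean)` for ONE real mean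
(`free_energy`), `…ReplicaJackknifeRatio` the pooled ratio of TWO means (`reweighted_mean`).  The
engine's derived numbers are, more generally, smooth functions of SEVERAL pooled means (`−log` of a
reweighted ratio, differences of sector weights, products of ratios), always with the same
delete-one-block jackknife (`estimators.jackknife`).  This file gives the general statement: block
estimates `α_r` in a real normed space `E`, `φ : E → ℝ` Fréchet-differentiable at the limit `a`
with derivative `L`, scaled deviations `v_r = √n (α_r − a)` converging JOINTLY in distribution to
some `Z = (Z_r)_r` whose scores `(L Z_r)_r` are `N(0, v)^{⊗R}` (`v ≠ 0`; e.g. `Z_r` i.i.d. centred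
Gaussian vectors with covariance `Σ`, `v = LΣLᵀ`).  Then for every bias-correction weight `κ` and
every `q ≥ 0` the jackknife-studentised deviation of `φ(ᾱ) + κ(φ(ᾱ) − φ̄_{(·)})` from `φ(a)` covers
with probability `→ L_R(q) = N(0,1)^{⊗R}{|t| ≤ q}`.  Mechanism: the EXACT identity
`√n (φ(ᾱ_S) − φ(a)) = L(v̄_S) + ρ(ᾱ_S)·‖v̄_S‖` with the signed remainder ratio
`ρ(x) = ‖x − a‖⁻¹ (φ x − φ a − L(x − a))` (continuous at `a`, `ρ(a) = 0`), so the studentised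
deviation is a fixed measurable `Ψ(v, α)`, continuous at `(z, a)` with value `t((L z_r)_r)` off the
diagonal; the limit variable is now a general `Z`, handled by §1.

* **`tendsto_measure_abs_le_of_perturbed_tStat_general`** (§1) — `X_n ⇒ X_∞` (any second-countable
  normed group), `Y_n → y₀` in probability, `T_n = Ψ(X_n, Y_n)` eventually, `Ψ` measurable and,
  a.s. in the limit space, continuous at `(X_∞, y₀)` with `Ψ(X_∞, y₀) = σ·t(S)`, `|σ| = 1`, for a
  score vector `S` of law `N(0, v)^{⊗R}` ⇒ `P(|T_n| ≤ q) → L_R(q)`.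
* `continuousAt_fderivRemainder`, `mul_sub_eq_apply_smul_add_remainder` (§2) — the signed remainder.
* **`tendsto_measure_abs_pooledJackknife_le_fderiv`** (§3, free `κ`).

NOT CLAIMED: the joint CLT for `E`-valued block estimates (the hypothesis); unequal block lengths;
`R → ∞` with `n`; anything numerical.
-/

namespace Summit.Ventures.LatticeQCDFlow.Exactness.GeneralNCMC

open MeasureTheory ProbabilityTheory Filter Finset WithLp
open scoped ENNReal NNReal Topology

/-! ## §1 Perturbed replica-`t` coverage with a general limit variable -/

section Perturbed

variable {ι : Type*} [Fintype ι] [Nontrivial ι]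
  {Ω₀ : Type*} [MeasurableSpace Ω₀] {P : Measure Ω₀} [IsProbabilityMeasure P]
  {Ω' : Type*} [MeasurableSpace Ω'] {P' : Measure Ω'} [IsProbabilityMeasure P']
  {E₀ : Type*} [NormedAddCommGroup E₀] [MeasurableSpace E₀] [BorelSpace E₀]
  [SecondCountableTopology E₀]
  {E' : Type*} [NormedAddCommGroup E'] [MeasurableSpace E'] [BorelSpace E']
  [SecondCountableTopology E']

/-- **PERTURBED REPLICA-`t` COVERAGE, GENERAL LIMIT.**  `X_n ⇒ X_∞` (second-countable normed
groups), `Y_n → y₀` in probability, eventually `T_n = Ψ(X_n, Y_n)` with `Ψ` measurable; on the limit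
space a score vector `S : Ω' → (ι → ℝ)` of law `N(0, v)^{⊗R}` (`v ≠ 0`, `R ≥ 2`) such that, almost
surely, `Ψ` is continuous at `(X_∞, y₀)` and `Ψ(X_∞, y₀) = σ·t(S)` (`|σ| = 1`).  Then
`P(|T_n| ≤ q) → L_R(q) = N(0,1)^{⊗R}{|t| ≤ q}` for every `q ≥ 0`. -/
theorem tendsto_measure_abs_le_of_perturbed_tStat_general
    {X : ℕ → Ω₀ → E₀} {Xinf : Ω' → E₀} {Y : ℕ → Ω₀ → E'} {y₀ : E'}
    (hX : TendstoInDistribution X atTop Xinf (fun _ => P) P')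
    (hY : TendstoInMeasure P Y atTop (fun _ => y₀)) (hYm : ∀ n, AEMeasurable (Y n) P)
    {S : Ω' → ι → ℝ} (hSm : AEMeasurable S P') {v : ℝ≥0} (hv : v ≠ 0)
    (hS : P'.map S = Measure.pi fun _ : ι => gaussianReal 0 v)
    {Ψ : E₀ × E' → ℝ} (hΨm : Measurable Ψ) {σ : ℝ} (hσ : |σ| = 1)
    (hcont : ∀ᵐ ω' ∂P', ContinuousAt Ψ (Xinf ω', y₀))
    (hval : ∀ᵐ ω' ∂P', Ψ (Xinf ω', y₀) = σ * ((∑ r, S ω' r) / Fintype.card ι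
        / Real.sqrt ((∑ r, (S ω' r - (∑ r', S ω' r') / Fintype.card ι) ^ 2)
            / ((Fintype.card ι : ℝ) * (Fintype.card ι - 1)))))
    {T : ℕ → Ω₀ → ℝ} (hT : ∀ᶠ n in atTop, ∀ ω, T n ω = Ψ (X n ω, Y n ω)) {q : ℝ} (hq : 0 ≤ q) :
    Tendsto (fun n => P {ω | |T n ω| ≤ q}) atTop
      (𝓝 ((Measure.pi fun _ : ι => gaussianReal 0 1) {z : ι → ℝ | |(∑ r, z r) / Fintype.card ι
        / Real.sqrt ((∑ r, (z r - (∑ r', z r') / Fintype.card ι) ^ 2)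
            / ((Fintype.card ι : ℝ) * (Fintype.card ι - 1)))| ≤ q})) := by
  set t : (ι → ℝ) → ℝ := fun z => (∑ r, z r) / Fintype.card ι
        / Real.sqrt ((∑ r, (z r - (∑ r', z r') / Fintype.card ι) ^ 2)
            / ((Fintype.card ι : ℝ) * (Fintype.card ι - 1))) with ht
  have htm : Measurable t := measurable_tStat_pi
  have hσ0 : σ ≠ 0 := fun h => by simp [h] at hσ
  have hσtS : AEMeasurable (fun ω' => σ * t (S ω')) P' := (htm.comp_aemeasurable hSm).const_mul σ
  -- Slutsky for the pair, a.e.-continuous mapping, then replace the limit variable by `σ · t(S)`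
  have hpair := hX.prodMk_of_tendstoInMeasure_const X Y Xinf hY hYm
  have hΨ : TendstoInDistribution (fun n ω => Ψ (X n ω, Y n ω)) atTop (fun ω' => σ * t (S ω'))
      (fun _ => P) P' :=
    (TendstoInDistribution.comp_of_ae_continuousAt hpair hΨm hcont).congr
      (fun n => Eventually.of_forall fun ω => rfl) hval
  -- the limit law is the image of `N(0, v)^{⊗R}` under `σ · t`; it does not charge `{−q, q}`
  have hlaw : P'.map (fun ω' => σ * t (S ω')) = (Measure.pi fun _ : ι => gaussianReal 0 v).map
      (fun z => σ * t z) := by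
    rw [← hS, AEMeasurable.map_map_of_aemeasurable (htm.const_mul σ).aemeasurable hSm]
    rfl
  have hnull : (P'.map fun ω' => σ * t (S ω')) (frontier (Set.Icc (-q) q)) = 0 := by
    rw [frontier_Icc (by linarith : -q ≤ q), hlaw]
    haveI : NullSingletonClass ((Measure.pi fun _ : ι => gaussianReal 0 v).map fun z => σ * t z) :=
      ⟨fun x => by
        rw [Measure.map_apply (htm.const_mul σ) (measurableSet_singleton x)]
        have hset : (fun z => σ * t z) ⁻¹' {x} = {z | t z = x / σ} := by
          ext z
          simp only [Set.mem_preimage, Set.mem_singleton_iff, Set.mem_setOf_eq]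
          rw [eq_div_iff hσ0, mul_comm]
        rw [hset]
        exact pi_gaussianReal_measure_tStat_eq_eq_zero 0 hv (x / σ)⟩
    exact (Set.toFinite {-q, q}).measure_zero _
  have key := ProbabilityMeasure.tendsto_measure_of_null_frontier_of_tendsto' hΨ.tendsto
    (E := Set.Icc (-q) q) (by simpa using hnull)
  simp only [ProbabilityMeasure.coe_mk] at key
  rw [hlaw, Measure.map_apply (htm.const_mul σ) measurableSet_Icc] at key
  have hlim : (fun z => σ * t z) ⁻¹' Set.Icc (-q) q = {z | |t z| ≤ q} := by
    ext z
    simp only [Set.mem_preimage, Set.mem_Icc, Set.mem_setOf_eq, ← abs_le, abs_mul, hσ, one_mul]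
  rw [hlim, ht] at key
  rw [← pi_gaussianReal_measure_abs_tStat_le_eq hv q]
  refine key.congr' ?_
  filter_upwards [hT] with n hn
  rw [Measure.map_apply_of_aemeasurable (hΨ.forall_aemeasurable n) measurableSet_Icc]
  congr 1
  ext ω
  simp only [Set.mem_preimage, Set.mem_Icc, Set.mem_setOf_eq, hn ω, abs_le]

end Perturbed

/-! ## §2 The signed Fréchet remainder ratio -/

section Remainder

variable {E : Type*} [NormedAddCommGroup E] [NormedSpace ℝ E]

/-- The SIGNED remainder ratio `ρ(x) = ‖x − a‖⁻¹ (φ x − φ a − L(x − a))` of a real function with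
Fréchet derivative `L` at `a` is continuous at `a`, where it vanishes. -/
theorem continuousAt_fderivRemainder {φ : E → ℝ} {L : E →L[ℝ] ℝ} {a : E} (hφ : HasFDerivAt φ L a) :
    ContinuousAt (fun x => ‖x - a‖⁻¹ * (φ x - φ a - L (x - a))) a := by
  have h := Summit.Ventures.LatticeQCDFlow.Scoring.CardConsistency.tendsto_fderivRemainderRatio hφ
  have h0 : ‖a - a‖⁻¹ * (φ a - φ a - L (a - a)) = 0 := by simp
  rw [ContinuousAt, h0, tendsto_zero_iff_norm_tendsto_zero]
  have h1 : ‖a - a‖⁻¹ * ‖φ a - φ a - L (a - a)‖ = 0 := by simp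
  rw [ContinuousAt, h1] at h
  refine h.congr fun x => ?_
  rw [norm_mul, norm_inv, norm_norm]

/-- The remainder ratio is measurable for measurable `φ`. -/
theorem measurable_fderivRemainder [MeasurableSpace E] [BorelSpace E] [SecondCountableTopology E]
    {φ : E → ℝ} (hφm : Measurable φ) (L : E →L[ℝ] ℝ) (a : E) :
    Measurable fun x => ‖x - a‖⁻¹ * (φ x - φ a - L (x - a)) :=
  (measurable_id.sub_const a).norm.inv.mul
    ((hφm.sub_const _).sub (L.continuous.measurable.comp (measurable_id.sub_const a)))

/-- **THE EXACT LINEARISATION WITH REMAINDER**: for `s ≥ 0`,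
`s (φ x − φ a) = L(s • (x − a)) + ρ(x) · ‖s • (x − a)‖`. -/
theorem mul_sub_eq_apply_smul_add_remainder (φ : E → ℝ) (L : E →L[ℝ] ℝ) (a x : E) {s : ℝ}
    (hs : 0 ≤ s) :
    s * (φ x - φ a) = L (s • (x - a)) + ‖x - a‖⁻¹ * (φ x - φ a - L (x - a)) * ‖s • (x - a)‖ := by
  rw [map_smul, smul_eq_mul, norm_smul, Real.norm_eq_abs, abs_of_nonneg hs]
  by_cases hx : x = a
  · subst hx
    simp
  · have hne : ‖x - a‖ ≠ 0 := norm_ne_zero_iff.2 (sub_ne_zero.2 hx)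
    field_simp
    ring

/-- Means commute with affine maps: `s • (m⁻¹ • Σ_S α − a) = m⁻¹ • Σ_S s • (α_r − a)` when
`m = |S| ≠ 0`. -/
theorem smul_invCard_smul_sum_sub {ι' : Type*} (S : Finset ι') (hS : (S.card : ℝ) ≠ 0)
    (α : ι' → E) (a : E) (s : ℝ) :
    s • ((S.card : ℝ)⁻¹ • (∑ r ∈ S, α r) - a) = (S.card : ℝ)⁻¹ • ∑ r ∈ S, s • (α r - a) := by
  rw [← Finset.smul_sum, Finset.sum_sub_distrib, Finset.sum_const, ← Nat.cast_smul_eq_nsmul ℝ]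
  match_scalars <;> field_simp

end Remainder

/-! ## §3 The jackknife of a smooth function of pooled `E`-valued means -/

section Main

variable {ι : Type*} [Fintype ι] [DecidableEq ι] [Nontrivial ι]
  {Ω₀ : Type*} [MeasurableSpace Ω₀] {P : Measure Ω₀} [IsProbabilityMeasure P]
  {Ω' : Type*} [MeasurableSpace Ω'] {P' : Measure Ω'} [IsProbabilityMeasure P']
  {E : Type*} [NormedAddCommGroup E] [NormedSpace ℝ E] [MeasurableSpace E] [BorelSpace E]
  [SecondCountableTopology E]

/-- **THE POOLED JACKKNIFE OF A SMOOTH FUNCTION OF SEVERAL MEANS COVERS WITH PROBABILITY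
`→ L_R(q)`.**
Block estimates `A_n : Ω → (ι → E)` in a second-countable real normed space (`R = card ι ≥ 2`), a
centre `a`, a measurable `φ : E → ℝ` with Fréchet derivative `L` at `a`; the scaled deviations
`(√n (A_{n,r} − a))_r` converge in distribution to some `Z` whose score vector `(L Z_r)_r` has law
`N(0, v)^{⊗R}` (`v ≠ 0`).  Then for every bias-correction weight `κ` and every `q ≥ 0` the
jackknife-studentised deviation of `φ(Ā_n) + κ(φ(Ā_n) − φ̄_{(·),n})` from `φ(a)` (pooled means
`Ā = R⁻¹ • Σ_r A_r`, `Ā_{(−r)} = (R−1)⁻¹ • Σ_{s≠r} A_s`) is at most `q` in absolute value with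
probability `→ N(0,1)^{⊗R}{|t| ≤ q}`. -/
theorem tendsto_measure_abs_pooledJackknife_le_fderiv {A : ℕ → Ω₀ → ι → E}
    (hA : ∀ n, Measurable (A n)) {a : E} {φ : E → ℝ} (hφm : Measurable φ) {L : E →L[ℝ] ℝ}
    (hφ : HasFDerivAt φ L a) {Z : Ω' → ι → E}
    (hV : TendstoInDistribution (fun (n : ℕ) ω => fun r => Real.sqrt (n : ℝ) • (A n ω r - a))
      atTop Z (fun _ => P) P')
    {v : ℝ≥0} (hv : v ≠ 0)
    (hS : P'.map (fun ω' r => L (Z ω' r)) = Measure.pi fun _ : ι => gaussianReal 0 v)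
    (κ : ℝ) {q : ℝ} (hq : 0 ≤ q) :
    Tendsto (fun n => P {ω |
      |(φ ((Fintype.card ι : ℝ)⁻¹ • ∑ r, A n ω r)
          + κ * (φ ((Fintype.card ι : ℝ)⁻¹ • ∑ r, A n ω r)
            - (∑ t, φ (((Fintype.card ι : ℝ) - 1)⁻¹ • ∑ r ∈ univ.erase t, A n ω r))
                / Fintype.card ι)
          - φ a)
        / Real.sqrt (((Fintype.card ι : ℝ) - 1) / Fintype.card ι
          * ∑ r, (φ (((Fintype.card ι : ℝ) - 1)⁻¹ • ∑ u ∈ univ.erase r, A n ω u)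
            - (∑ t, φ (((Fintype.card ι : ℝ) - 1)⁻¹ • ∑ u ∈ univ.erase t, A n ω u))
                / Fintype.card ι) ^ 2)| ≤ q}) atTop
      (𝓝 ((Measure.pi fun _ : ι => gaussianReal 0 1) {z : ι → ℝ | |(∑ r, z r) / Fintype.card ι
        / Real.sqrt ((∑ r, (z r - (∑ r', z r') / Fintype.card ι) ^ 2)
            / ((Fintype.card ι : ℝ) * (Fintype.card ι - 1)))| ≤ q})) := by
  have hR2 : (2 : ℝ) ≤ Fintype.card ι := by
    exact_mod_cast (Fintype.one_lt_card : 2 ≤ Fintype.card ι)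
  have hR0 : (Fintype.card ι : ℝ) ≠ 0 := by positivity
  have hR1 : (Fintype.card ι : ℝ) - 1 ≠ 0 := by linarith
  have hRpos : (0 : ℝ) < (Fintype.card ι : ℝ) * (Fintype.card ι - 1) :=
    mul_pos (by linarith) (by linarith)
  -- the signed remainder ratio
  set ρ : E → ℝ := fun x => ‖x - a‖⁻¹ * (φ x - φ a - L (x - a)) with hρ
  have hρm : Measurable ρ := measurable_fderivRemainder hφm L a
  have hρc : ContinuousAt ρ a := continuousAt_fderivRemainder hφ
  have hρa : ρ a = 0 := by simp [hρ]
  -- the scale-free function of the pair (scaled deviations, block estimates)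
  set Ψ : (ι → E) × (ι → E) → ℝ := fun p =>
    (L ((Fintype.card ι : ℝ)⁻¹ • ∑ r, p.1 r)
        + ρ ((Fintype.card ι : ℝ)⁻¹ • ∑ r, p.2 r) * ‖(Fintype.card ι : ℝ)⁻¹ • ∑ r, p.1 r‖
        + κ * (L ((Fintype.card ι : ℝ)⁻¹ • ∑ r, p.1 r)
          + ρ ((Fintype.card ι : ℝ)⁻¹ • ∑ r, p.2 r) * ‖(Fintype.card ι : ℝ)⁻¹ • ∑ r, p.1 r‖
          - (∑ t, (L (((Fintype.card ι : ℝ) - 1)⁻¹ • ∑ r ∈ univ.erase t, p.1 r)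
              + ρ (((Fintype.card ι : ℝ) - 1)⁻¹ • ∑ r ∈ univ.erase t, p.2 r)
                * ‖((Fintype.card ι : ℝ) - 1)⁻¹ • ∑ r ∈ univ.erase t, p.1 r‖))
                / Fintype.card ι))
      / Real.sqrt (((Fintype.card ι : ℝ) - 1) / Fintype.card ι
        * ∑ r, (L (((Fintype.card ι : ℝ) - 1)⁻¹ • ∑ u ∈ univ.erase r, p.1 u)
              + ρ (((Fintype.card ι : ℝ) - 1)⁻¹ • ∑ u ∈ univ.erase r, p.2 u)
                * ‖((Fintype.card ι : ℝ) - 1)⁻¹ • ∑ u ∈ univ.erase r, p.1 u‖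
          - (∑ t, (L (((Fintype.card ι : ℝ) - 1)⁻¹ • ∑ u ∈ univ.erase t, p.1 u)
              + ρ (((Fintype.card ι : ℝ) - 1)⁻¹ • ∑ u ∈ univ.erase t, p.2 u)
                * ‖((Fintype.card ι : ℝ) - 1)⁻¹ • ∑ u ∈ univ.erase t, p.1 u‖))
                / Fintype.card ι) ^ 2) with hΨ
  have hLm : Measurable L := L.continuous.measurable
  have hΨm : Measurable Ψ := by rw [hΨ]; fun_prop
  -- block estimates → `a` in probability (pinned by the CLT)
  have hY : TendstoInMeasure P (fun n ω => A n ω) atTop (fun _ => fun _ : ι => a) :=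
    Scoring.CardConsistency.tendstoInMeasure_of_tendstoInDistribution_smul
      (a := fun n : ℕ => Real.sqrt (n : ℝ))
      (Real.tendsto_sqrt_atTop.comp tendsto_natCast_atTop_atTop) (Z := Z) (P' := P') hV
  -- means of the constant vector
  have hev : ∀ t : ι, ((Fintype.card ι : ℝ) - 1)⁻¹ • ∑ _r ∈ univ.erase t, a = a := fun t => by
    rw [sum_const, ← Nat.cast_smul_eq_nsmul ℝ, card_univ_erase_cast, smul_smul,
      inv_mul_cancel₀ hR1, one_smul]
  have hevm : (Fintype.card ι : ℝ)⁻¹ • ∑ _r : ι, a = a := by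
    rw [sum_const, card_univ, ← Nat.cast_smul_eq_nsmul ℝ, smul_smul, inv_mul_cancel₀ hR0, one_smul]
  -- `L` passes through means; the jackknife algebra at `c = 1`
  have hLmean : ∀ (S : Finset ι) (c : ℝ) (z : ι → E),
      L (c⁻¹ • ∑ r ∈ S, z r) = (∑ r ∈ S, L (z r)) / c := fun S c z => by
    rw [map_smul, map_sum, smul_eq_mul, inv_mul_eq_div]
  have hmean1 : ∀ y : ι → ℝ, (∑ t, (∑ s ∈ univ.erase t, y s) / ((Fintype.card ι : ℝ) - 1))
      / Fintype.card ι = (∑ s, y s) / Fintype.card ι := fun y => by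
    simpa only [one_mul] using sum_const_mul_looMean_div hR1 y 1
  have hvar1 : ∀ y : ι → ℝ, ((Fintype.card ι : ℝ) - 1) / Fintype.card ι
      * ∑ r, ((∑ s ∈ univ.erase r, y s) / ((Fintype.card ι : ℝ) - 1)
        - (∑ t, (∑ s ∈ univ.erase t, y s) / ((Fintype.card ι : ℝ) - 1)) / Fintype.card ι) ^ 2
      = (∑ r, (y r - (∑ s, y s) / Fintype.card ι) ^ 2)
          / ((Fintype.card ι : ℝ) * (Fintype.card ι - 1)) := fun y => by
    simpa only [one_mul, one_pow] using jackknife_variance_const_mul_looMean hR0 hR1 y 1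
  -- the value `Ψ(z, a) = t((L z_r)_r)` for EVERY `z`
  have hval : ∀ z : ι → E, Ψ (z, fun _ : ι => a) = 1 * ((∑ r, L (z r)) / Fintype.card ι
        / Real.sqrt ((∑ r, (L (z r) - (∑ r', L (z r')) / Fintype.card ι) ^ 2)
            / ((Fintype.card ι : ℝ) * (Fintype.card ι - 1)))) := by
    intro z
    simp only [hΨ, hev, hevm, hρa, zero_mul, add_zero, hLmean]
    rw [hvar1, hmean1, sub_self, mul_zero, add_zero, one_mul]
  -- continuity of `Ψ` at `(z, a)` off the diagonal of the scores, hence a.s. at `(Z, a)`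
  have hLc : Continuous fun (z : ι → E) (r : ι) => L (z r) :=
    continuous_pi fun r => L.continuous.comp (continuous_apply r)
  have hSm : AEMeasurable (fun ω' r => L (Z ω' r)) P' :=
    hLc.measurable.comp_aemeasurable hV.aemeasurable_limit
  have hae : ∀ᵐ ω' ∂P', (∑ r, (L (Z ω' r) - (∑ r', L (Z ω' r')) / Fintype.card ι) ^ 2) ≠ 0 := by
    have h := ae_sumSqDev_ne_zero_pi_gaussianReal (ι := ι) 0 hv
    rw [← hS] at h
    exact ae_of_ae_map hSm h
  have hcont : ∀ᵐ ω' ∂P', ContinuousAt Ψ (Z ω', fun _ : ι => a) := by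
    filter_upwards [hae] with ω' hz
    set p₀ : (ι → E) × (ι → E) := (Z ω', fun _ : ι => a) with hp₀
    have hm1 : ∀ (S : Finset ι) (c : ℝ), Continuous fun p : (ι → E) × (ι → E) =>
        c⁻¹ • ∑ r ∈ S, p.1 r := fun S c => by fun_prop
    have hm2 : ∀ (S : Finset ι) (c : ℝ), Continuous fun p : (ι → E) × (ι → E) =>
        c⁻¹ • ∑ r ∈ S, p.2 r := fun S c => by fun_prop
    -- each linearised-plus-remainder term is continuous at `p₀`
    have hg : ∀ (S : Finset ι) (c : ℝ), c⁻¹ • ∑ _r ∈ S, a = a →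
        ContinuousAt (fun p : (ι → E) × (ι → E) => L (c⁻¹ • ∑ r ∈ S, p.1 r)
          + ρ (c⁻¹ • ∑ r ∈ S, p.2 r) * ‖c⁻¹ • ∑ r ∈ S, p.1 r‖) p₀ := by
      intro S c hc
      refine (L.continuous.continuousAt.comp (hm1 S c).continuousAt).add
        ((hρc.comp_of_eq (hm2 S c).continuousAt ?_).mul (hm1 S c).norm.continuousAt)
      simp only [hp₀]
      exact hc
    have hgu := hg univ (Fintype.card ι : ℝ) hevm
    have hgt : ∀ t, ContinuousAt _ p₀ := fun t =>
      hg (univ.erase t) ((Fintype.card ι : ℝ) - 1) (hev t)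
    have hSum : ContinuousAt (fun p : (ι → E) × (ι → E) =>
        (∑ t, (L (((Fintype.card ι : ℝ) - 1)⁻¹ • ∑ r ∈ univ.erase t, p.1 r)
          + ρ (((Fintype.card ι : ℝ) - 1)⁻¹ • ∑ r ∈ univ.erase t, p.2 r)
            * ‖((Fintype.card ι : ℝ) - 1)⁻¹ • ∑ r ∈ univ.erase t, p.1 r‖)) / Fintype.card ι) p₀ :=
      (tendsto_finsetSum _ fun t _ => hgt t).div_const _
    have hJpos : 0 < (∑ r, (L (Z ω' r) - (∑ r', L (Z ω' r')) / Fintype.card ι) ^ 2)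
          / ((Fintype.card ι : ℝ) * (Fintype.card ι - 1)) :=
      div_pos (lt_of_le_of_ne (sum_nonneg fun r _ => sq_nonneg _) (Ne.symm hz)) hRpos
    rw [hΨ]
    refine (hgu.add (continuousAt_const.mul (hgu.sub hSum))).div
      (Real.continuous_sqrt.continuousAt.comp (continuousAt_const.mul
        (tendsto_finsetSum _ fun r _ => ((hgt r).sub hSum).pow 2))) ?_
    simp only [hp₀, hev, hρa, zero_mul, add_zero, hLmean]
    rw [hvar1]
    exact (Real.sqrt_pos.2 hJpos).ne'
  refine tendsto_measure_abs_le_of_perturbed_tStat_general hV hY (fun n => (hA n).aemeasurable)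
    hSm hv hS hΨm (σ := 1) (by simp) hcont (Eventually.of_forall fun ω' => hval (Z ω')) ?_ hq
  -- the exact `√n`-scaling identity, for `n ≥ 1`
  filter_upwards [eventually_gt_atTop 0] with n hn ω
  have hs : 0 < Real.sqrt (n : ℝ) := Real.sqrt_pos.2 (by exact_mod_cast hn)
  have hlin : ∀ x, Real.sqrt (n : ℝ) * (φ x - φ a)
      = L (Real.sqrt (n : ℝ) • (x - a)) + ρ x * ‖Real.sqrt (n : ℝ) • (x - a)‖ :=
    fun x => mul_sub_eq_apply_smul_add_remainder φ L a x hs.le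
  have hfull : Real.sqrt (n : ℝ) • ((Fintype.card ι : ℝ)⁻¹ • (∑ r, A n ω r) - a)
      = (Fintype.card ι : ℝ)⁻¹ • ∑ r, Real.sqrt (n : ℝ) • (A n ω r - a) := by
    simpa only [card_univ] using
      smul_invCard_smul_sum_sub univ (by simpa only [card_univ] using hR0) (A n ω) a (Real.sqrt n)
  have hloo : ∀ t,
      Real.sqrt (n : ℝ) • (((Fintype.card ι : ℝ) - 1)⁻¹ • (∑ r ∈ univ.erase t, A n ω r) - a)
      = ((Fintype.card ι : ℝ) - 1)⁻¹ • ∑ r ∈ univ.erase t, Real.sqrt (n : ℝ) • (A n ω r - a) := by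
    intro t
    have h := smul_invCard_smul_sum_sub (univ.erase t)
      (by rw [card_univ_erase_cast]; exact hR1) (A n ω) a (Real.sqrt n)
    rwa [card_univ_erase_cast] at h
  rw [hΨ, studentised_biasCorrected_scale _ (φ a) κ _ hs]
  simp only [hlin, hfull, hloo]

end Main

end Summit.Ventures.LatticeQCDFlow.Exactness.GeneralNCMC
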